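import Mathlib.Geometry.Manifold.SmoothEmbedding
import Mathlib.Geometry.Manifold.Instances.Real
import Mathlib.Topology.Algebra.Module.FiniteDimension
import Literature.Topology.FourManifolds.BallGluingCharts
import Literature.Geometry.Manifold.MaximalAtlasGroupoid
import HarnessLib

/-!
# Slice charts of a smoothly embedded hypersurface with boundary

Topic `Literature/Topology/FourManifolds` (consumer-side work for the fact seat
`provefact-Literature.Topology.FourManifolds.Trisection.isConnectedSum_circleProd_of_reducing_nonseparating`:
the handlebodies `H_q = h(H)` of a Gay–Kirby trisection are images of smooth embeddings of
`3`-manifolds with boundary (clause (iii) of `IsGKTrisection`); the local side indicators of a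
compressing disc in `H_q` are read in a chart of `X` in which `H_q` is a linear half-`3`-space).
**Everything here is proved; no new facts.**

`Literature.Topology.FourManifolds.exists_sliceChart_of_isSmoothEmbedding`: for a `C^∞` embedding
`f : M → X` of an `m`-manifold with boundary into an `(m+1)`-manifold modelled on `ℝᵐ⁺¹` and a
point `x₀ ∈ M`, there is a chart `Ξ` of the MAXIMAL atlas of `X` at `f x₀` and an open `V ∋ f x₀`
in its source on which `range f = {Ξ⁰ = 0, Ξ¹ ≥ 0}` and `f(∂M) = {Ξ⁰ = 0, Ξ¹ = 0}`.  Proof: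
Mathlib's immersion data `ψ ∘ f ∘ φ⁻¹ = L ∘ (·, 0)` (`Manifold.IsImmersionAt.writtenInCharts`,
`L : ℝᵐ × C ≃L ℝᵐ⁺¹`, so `dim C = 1`); re-coordinatise `ψ` by the linear automorphism
`A = J ∘ L⁻¹`, `J (u, c) = (λ c, u₀, …, u_{m-1})` (`λ : C ≃L ℝ`), which stays in the maximal atlas
(`Literature.Geometry.Manifold.trans_continuousLinearEquiv_mem_maximalAtlas`); the half-space
coordinate `u₀ ≥ 0` detects the boundary (invariance of the boundary for the maximal atlas,
`isBoundaryPoint_iff_of_mem_maximalAtlas`, Lee 2013, Thm. 1.46); `f` being an embedding, a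
neighbourhood `V` of `f x₀` meets `range f` only in `f(φ.source)`.

## References

* J. M. Lee, *Introduction to Smooth Manifolds*, 2nd ed., Springer GTM 218 (2013), Thm. 1.46,
  Thm. 5.8 / Prop. 5.49 (local slice criterion for embedded submanifolds, with boundary).
  [LeeSmoothManifolds2013]
-/

noncomputable section

open Set Function Filter Manifold Module
open scoped Manifold ContDiff Topology

namespace Literature.Topology.FourManifolds

/-- **Slice chart of a smoothly embedded hypersurface with boundary.**  Let `f : M → X` be a
`C^∞` embedding of an `m`-manifold with boundary `M` (model `EuclideanHalfSpace m`) into a manifold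
`X` modelled on `ℝᵐ⁺¹`, and `x₀ ∈ M`.  Then there are a chart `Ξ` of the maximal `C^∞` atlas of `X`
and an open set `V` with `f x₀ ∈ V ⊆ Ξ.source` such that for `x ∈ V`:
`x ∈ range f ↔ Ξ x 0 = 0 ∧ 0 ≤ Ξ x 1`, and `x ∈ f (∂M) ↔ Ξ x 0 = 0 ∧ Ξ x 1 = 0`
(local half-slice form of an embedded hypersurface with boundary, Lee 2013, Thm. 5.8 and
Prop. 5.49; boundary invariance Thm. 1.46).
[cite: LeeSmoothManifolds2013, Thm. 1.46 and Thm. 5.8] -/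
theorem exists_sliceChart_of_isSmoothEmbedding
    {m : ℕ} [NeZero m] {X : Type*} [TopologicalSpace X]
    [ChartedSpace (EuclideanSpace ℝ (Fin (m + 1))) X]
    [IsManifold (𝓡 (m + 1)) ∞ X]
    {M : Type*} [TopologicalSpace M] [ChartedSpace (EuclideanHalfSpace m) M]
    [IsManifold (𝓡∂ m) ∞ M]
    {f : M → X} (hf : IsSmoothEmbedding (𝓡∂ m) (𝓡 (m + 1)) ∞ f) (x₀ : M) :
    ∃ (Ξ : OpenPartialHomeomorph X (EuclideanSpace ℝ (Fin (m + 1)))) (V : Set X),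
      Ξ ∈ IsManifold.maximalAtlas (𝓡 (m + 1)) ∞ X ∧ IsOpen V ∧ f x₀ ∈ V ∧ V ⊆ Ξ.source ∧
      (∀ x ∈ V, x ∈ range f ↔ Ξ x 0 = 0 ∧ 0 ≤ Ξ x 1) ∧
      (∀ x ∈ V, x ∈ f '' {y | (𝓡∂ m).IsBoundaryPoint y} ↔ Ξ x 0 = 0 ∧ Ξ x 1 = 0) := by
  -- Mathlib's immersion data at `x₀`
  have h : IsImmersionAt (𝓡∂ m) (𝓡 (m + 1)) ∞ f x₀ := hf.isImmersion.isImmersionAt x₀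
  set φ := h.domChart with hφ_def
  set ψ := h.codChart with hψ_def
  set L := h.equiv with hL_def
  have hφ : φ ∈ IsManifold.maximalAtlas (𝓡∂ m) ∞ M := h.domChart_mem_maximalAtlas
  have hψ : ψ ∈ IsManifold.maximalAtlas (𝓡 (m + 1)) ∞ X := h.codChart_mem_maximalAtlas
  have hx₀φ : x₀ ∈ φ.source := h.mem_domChart_source
  have hfx₀ψ : f x₀ ∈ ψ.source := h.mem_codChart_source
  have hsrc : φ.source ⊆ f ⁻¹' ψ.source := h.source_subset_preimage_source
  have hwr : EqOn ((ψ.extend (𝓡 (m + 1))) ∘ f ∘ (φ.extend (𝓡∂ m)).symm) (L ∘ (·, 0))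
      (φ.extend (𝓡∂ m)).target := h.writtenInCharts
  have hψext : ∀ x, ψ.extend (𝓡 (m + 1)) x = ψ x := fun x => by simp
  -- the complement is a line
  haveI : FiniteDimensional ℝ h.complement := by
    have hinj : Injective
        ((L : (EuclideanSpace ℝ (Fin m) × h.complement) →ₗ[ℝ] EuclideanSpace ℝ (Fin (m + 1))).comp
          (LinearMap.inr ℝ (EuclideanSpace ℝ (Fin m)) h.complement)) :=
      L.injective.comp fun a b hab => (Prod.ext_iff.1 hab).2
    exact FiniteDimensional.of_injective _ hinj
  have hdimC : finrank ℝ h.complement = finrank ℝ ℝ := by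
    have h1 := L.toLinearEquiv.finrank_eq
    rw [Module.finrank_prod, finrank_euclideanSpace_fin, finrank_euclideanSpace_fin] at h1
    rw [Module.finrank_self]
    omega
  set lam : h.complement ≃L[ℝ] ℝ := ContinuousLinearEquiv.ofFinrankEq hdimC with hlam
  -- the re-coordinatisation `J (u, c) = (λ c, u)`
  set J : (EuclideanSpace ℝ (Fin m) × h.complement) ≃L[ℝ] EuclideanSpace ℝ (Fin (m + 1)) :=
    ((((EuclideanSpace.equiv (Fin m) ℝ).prodCongr lam).trans
      (ContinuousLinearEquiv.prodComm ℝ (Fin m → ℝ) ℝ)).trans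
      (Fin.consEquivL ℝ (fun _ : Fin (m + 1) => ℝ))).trans
      (EuclideanSpace.equiv (Fin (m + 1)) ℝ).symm with hJ
  have hJ0 : ∀ u c, J (u, c) 0 = lam c := by
    intro u c
    simp [hJ]
  have hone : (1 : Fin (m + 1)) = Fin.succ 0 := by
    have hm : 1 < m + 1 := by have := NeZero.pos m; omega
    refine Fin.ext ?_
    rw [Fin.val_succ, Fin.val_zero, Fin.val_one', Nat.mod_eq_of_lt hm]
  have hJ1 : ∀ u c, J (u, c) 1 = u 0 := by
    intro u c
    rw [hone]
    simp [hJ, -Fin.succ_zero_eq_one, -Fin.succ_zero_eq_one']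
  set A : EuclideanSpace ℝ (Fin (m + 1)) ≃L[ℝ] EuclideanSpace ℝ (Fin (m + 1)) :=
    L.symm.trans J with hA
  set Ξ : OpenPartialHomeomorph X (EuclideanSpace ℝ (Fin (m + 1))) :=
    ψ.trans A.toHomeomorph.toOpenPartialHomeomorph with hΞ_def
  have hΞ : Ξ ∈ IsManifold.maximalAtlas (𝓡 (m + 1)) ∞ X :=
    Literature.Geometry.Manifold.trans_continuousLinearEquiv_mem_maximalAtlas hψ A
  have hΞsrc : Ξ.source = ψ.source := by simp [hΞ_def]
  have hΞapply : ∀ x, Ξ x = J (L.symm (ψ x)) := fun x => rfl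
  -- coordinates of the points of `range f`
  have hsymm_src : ∀ u ∈ (φ.extend (𝓡∂ m)).target, (φ.extend (𝓡∂ m)).symm u ∈ φ.source := by
    intro u hu
    have := (φ.extend (𝓡∂ m)).map_target hu
    rwa [OpenPartialHomeomorph.extend_source] at this
  have hcoord : ∀ u ∈ (φ.extend (𝓡∂ m)).target,
      Ξ (f ((φ.extend (𝓡∂ m)).symm u)) 0 = 0 ∧ Ξ (f ((φ.extend (𝓡∂ m)).symm u)) 1 = u 0 := by
    intro u hu
    have h1 : ψ (f ((φ.extend (𝓡∂ m)).symm u)) = L (u, 0) := by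
      rw [← hψext]; exact hwr hu
    rw [hΞapply, h1, ContinuousLinearEquiv.symm_apply_apply, hJ0, hJ1, map_zero]
    exact ⟨rfl, rfl⟩
  -- the converse: points with `Ξ⁰ = 0` and first slice coordinate in the chart image
  set Ω₀ : Set (EuclideanSpace ℝ (Fin m)) := (𝓡∂ m).symm ⁻¹' φ.target with hΩ₀_def
  have hΩ₀o : IsOpen Ω₀ := φ.open_target.preimage (𝓡∂ m).continuous_symm
  have htarget : (φ.extend (𝓡∂ m)).target = Ω₀ ∩ {u | 0 ≤ u 0} := by
    rw [OpenPartialHomeomorph.extend_target, range_modelWithCornersEuclideanHalfSpace]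
  set pr : X → EuclideanSpace ℝ (Fin m) := fun x => (L.symm (ψ x)).1 with hpr
  have hback : ∀ x ∈ ψ.source, Ξ x 0 = 0 → pr x ∈ Ω₀ → 0 ≤ Ξ x 1 →
      pr x ∈ (φ.extend (𝓡∂ m)).target ∧ x = f ((φ.extend (𝓡∂ m)).symm (pr x)) := by
    intro x hx h0 hΩ h1
    have hc : (L.symm (ψ x)).2 = 0 := by
      have : lam (L.symm (ψ x)).2 = 0 := by rw [← hJ0 (L.symm (ψ x)).1]; exact h0
      exact lam.injective (by rw [this, map_zero])
    have hu1 : Ξ x 1 = pr x 0 := by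
      rw [hΞapply]
      conv_lhs => rw [show L.symm (ψ x) = ((L.symm (ψ x)).1, (L.symm (ψ x)).2) from rfl]
      rw [hJ1]
    have hut : pr x ∈ (φ.extend (𝓡∂ m)).target := by
      rw [htarget]
      refine ⟨hΩ, ?_⟩
      show 0 ≤ pr x 0
      rw [← hu1]; exact h1
    refine ⟨hut, ?_⟩
    have h2 : ψ x = L (pr x, 0) := by
      conv_lhs => rw [← L.apply_symm_apply (ψ x),
        show L.symm (ψ x) = ((L.symm (ψ x)).1, (L.symm (ψ x)).2) from rfl, hc]
    have h3 : ψ (f ((φ.extend (𝓡∂ m)).symm (pr x))) = L (pr x, 0) := by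
      rw [← hψext]; exact hwr hut
    have hfs : f ((φ.extend (𝓡∂ m)).symm (pr x)) ∈ ψ.source := hsrc (hsymm_src _ hut)
    exact ψ.injOn hx hfs (h2.trans h3.symm)
  -- boundary points
  have hbdry : ∀ y ∈ φ.source, ((𝓡∂ m).IsBoundaryPoint y ↔ (φ.extend (𝓡∂ m) y) 0 = 0) := by
    intro y hy
    rw [isBoundaryPoint_iff_of_mem_maximalAtlas (by simp) hφ hy,
      frontier_range_modelWithCornersEuclideanHalfSpace]
    exact ⟨fun h => (h : (0 : ℝ) = _).symm, fun h => (h.symm : (0 : ℝ) = _)⟩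
  -- the open set `V`
  obtain ⟨t, ht, hft⟩ := hf.isEmbedding.isInducing.isOpen_iff.1 φ.open_source
  have hprc : ContinuousOn pr ψ.source :=
    (continuous_fst.comp L.symm.continuous).comp_continuousOn ψ.continuousOn
  obtain ⟨V₁, hV₁o, hV₁⟩ : ∃ V₁ : Set X, IsOpen V₁ ∧ V₁ ∩ ψ.source = ψ.source ∩ pr ⁻¹' Ω₀ := by
    obtain ⟨V₁, hV₁o, hV₁⟩ := (continuousOn_iff'.1 hprc) Ω₀ hΩ₀o
    exact ⟨V₁, hV₁o, by rw [← hV₁, inter_comm]⟩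
  set V : Set X := t ∩ ψ.source ∩ V₁ with hV_def
  have hVo : IsOpen V := (ht.inter ψ.open_source).inter hV₁o
  have hVpr : ∀ x ∈ V, pr x ∈ Ω₀ := by
    intro x hx
    have : x ∈ V₁ ∩ ψ.source := ⟨hx.2, hx.1.2⟩
    rw [hV₁] at this
    exact this.2
  -- points of `range f ∩ V` come from `φ.source`
  have hfront : ∀ y, f y ∈ V → y ∈ φ.source := by
    intro y hy
    have : y ∈ f ⁻¹' t := hy.1.1
    rwa [hft] at this
  have hpr_f : ∀ y ∈ φ.source, pr (f y) = φ.extend (𝓡∂ m) y := by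
    intro y hy
    have hut : φ.extend (𝓡∂ m) y ∈ (φ.extend (𝓡∂ m)).target :=
      (φ.extend (𝓡∂ m)).map_source (by rwa [OpenPartialHomeomorph.extend_source])
    have h1 : ψ (f y) = L (φ.extend (𝓡∂ m) y, 0) := by
      have := hwr hut
      simp only [comp_apply] at this
      rw [(φ.extend (𝓡∂ m)).left_inv (by rwa [OpenPartialHomeomorph.extend_source])] at this
      rw [← hψext]; exact this
    simp [hpr, h1]
  refine ⟨Ξ, V, hΞ, hVo, ?_, ?_, ?_, ?_⟩
  · -- `f x₀ ∈ V`
    refine ⟨⟨?_, hfx₀ψ⟩, ?_⟩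
    · show x₀ ∈ f ⁻¹' t
      rw [hft]; exact hx₀φ
    · have : f x₀ ∈ ψ.source ∩ pr ⁻¹' Ω₀ := by
        refine ⟨hfx₀ψ, ?_⟩
        show pr (f x₀) ∈ Ω₀
        rw [hpr_f x₀ hx₀φ]
        exact (htarget ▸ (φ.extend (𝓡∂ m)).map_source
          (by rwa [OpenPartialHomeomorph.extend_source]) :
            φ.extend (𝓡∂ m) x₀ ∈ Ω₀ ∩ {u | 0 ≤ u 0}).1
      rw [← hV₁] at this
      exact this.1
  · -- `V ⊆ Ξ.source`
    intro x hx
    rw [hΞsrc]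
    exact hx.1.2
  · -- `range f` is the half slice
    intro x hx
    constructor
    · rintro ⟨y, rfl⟩
      have hy := hfront y hx
      have hut : φ.extend (𝓡∂ m) y ∈ (φ.extend (𝓡∂ m)).target :=
        (φ.extend (𝓡∂ m)).map_source (by rwa [OpenPartialHomeomorph.extend_source])
      have := hcoord _ hut
      rw [(φ.extend (𝓡∂ m)).left_inv (by rwa [OpenPartialHomeomorph.extend_source])] at this
      exact ⟨this.1, this.2 ▸ (htarget ▸ hut).2⟩
    · rintro ⟨h0, h1⟩
      obtain ⟨-, hx'⟩ := hback x hx.1.2 h0 (hVpr x hx) h1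
      exact ⟨_, hx'.symm⟩
  · -- the boundary is the corner of the half slice
    intro x hx
    constructor
    · rintro ⟨y, hyb, rfl⟩
      have hy := hfront y hx
      have hut : φ.extend (𝓡∂ m) y ∈ (φ.extend (𝓡∂ m)).target :=
        (φ.extend (𝓡∂ m)).map_source (by rwa [OpenPartialHomeomorph.extend_source])
      have := hcoord _ hut
      rw [(φ.extend (𝓡∂ m)).left_inv (by rwa [OpenPartialHomeomorph.extend_source])] at this
      exact ⟨this.1, this.2.trans ((hbdry y hy).1 hyb)⟩
    · rintro ⟨h0, h1⟩
      obtain ⟨hut, hx'⟩ := hback x hx.1.2 h0 (hVpr x hx) h1.ge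
      refine ⟨(φ.extend (𝓡∂ m)).symm (pr x), ?_, hx'.symm⟩
      show (𝓡∂ m).IsBoundaryPoint _
      rw [hbdry _ (hsymm_src _ hut), (φ.extend (𝓡∂ m)).right_inv hut]
      have := (hcoord _ hut).2
      rw [← hx'] at this
      rw [← this, h1]

end Literature.Topology.FourManifolds
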